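import Summits.BirchSwinnertonDyer.Rank1Residual.X2.NonPrimitiveQuotientCorank
import Summits.BirchSwinnertonDyer.Rank1Residual.X2.NonPrimitiveSelmerCorank
import Summits.BirchSwinnertonDyer.Rank1Residual.X2.DualRestrictionSelmer
import Summits.BirchSwinnertonDyer.Rank1Residual.Iwasawa.DatumSelmerNonPrimitiveInvariants
import HarnessLib

/-!
# The `λ`-SHIFT of the non-primitive datum Selmer group IN THE KERNEL:
# `λ(X^{Σ₀}) = λ(X) + corank_{ℤ_p}(S^{Σ₀}_A(K_∞)/S_A(K_∞))`, hence
# `λ(X^{Σ₀}) ≤ λ(X) + Σ_{v∈Σ₀} N_v c_v` from per-place corank bounds (Greenberg–Vatsal 2000 Cor. (2.3),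
# conclusion 4, UPPER HALF) — cell `b2b-bsdres`, unit `b2b-bsdres-eisenstein-p2`, gen 30, programme P1

HONEST FRAMING (run/shared/lean/b2b/bsd-rank1-residual/, verbatim in every file): the goal of the
cell is to DELETE the COMBINATION-SHAPED residual classes of the Birch–Swinnerton-Dyer formula for
ALL analytic-rank `≤ 1` elliptic curves over `ℚ` — "full BSD formula for every rank `≤ 1` curve in
class `C`" assembled STRICTLY from published theorems — so that the rank-`≤ 1` remainder becomes
exactly the CONSTRUCTION-SHAPED classes, which are TYPED (missing-input `Prop`s), NOT attempted.
This is not "finishing BSD". Research route; NO CLAIM BEYOND STATED CLASSES; nothing here changes a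
label. Theorems only; no definition, no named fact, no `sorry`.

WHAT. `K` a number field, `E/K` elliptic, `p` prime, `κ` a `ℤ_p`-extension (`H = ker κ`) with
topological generator `γ`, `L` ANY Greenberg data for `A = E[p^∞]`, `S₀` a finite set of places whose
members `v ∤ p` are finitely decomposed in `K_∞` (`hD`; automatic in the cyclotomic tower), `X` a
dual datum of `S = S_A(K_∞)` finitely generated and `Λ`-torsion, `X₀` a dual datum of
`S^{S₀} = S^{Σ₀}_A(K_∞)` (`GreenbergVatsal2000.DatumDualData`). Team n1011's
`datumSelmer_nonPrimitive_moduleFinite_isTorsion_mu_eq` proved conclusions 1–3 of GV Cor. (2.3)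
(`X₀` f.g., torsion, `μ(X₀) = μ(X)`) and `λ(X) ≤ λ(X₀)`. HERE:

* §1 `nonempty_ker_addEquiv_characterModule` — the kernel of the dual restriction `r : X₀ ↠ X`
  (n1011's `exists_restrictDual`) is, as a group, `Hom(S^{S₀}/S, ℚ/ℤ)`.
* §2 **`lambdaInvariant_eq_add_zpCorank_quotient`** — the EXACT shift
  `λ(X₀) = λ(X) + corank_{ℤ_p}(S^{S₀}/S)` (with conclusions 1–3 restated): `λ` is additive along
  `r` (`DualRestrictionInvariants.lambdaInvariant_eq_add_of_surjective`), `ker r` is f.g. torsion with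
  `μ = 0` (`(ker r)/p` finite, n1011's `finite_modN_ker_of_cover`), so
  `λ(ker r) = corank_{ℤ_p}(S^{S₀}/S)` (`NonPrimitiveSelmerCorank.finite_torsionBy_and_zpCorank_eq_lambdaInvariant`).
  GV p. 21: "`corank_𝒪` of a `Λ`-cotorsion group being the `λ`-invariant of its dual".
* §3 **`lambdaInvariant_le_add_sum_of_local`** — with the representative property `hrep` and the
  per-place corank bounds `hloc` of `NonPrimitiveQuotientCorank.zpCorank_quotient_le_sum`:
  `λ(X₀) ≤ λ(X) + Σ_{v∈S₀} N_v c_v`. For `E/ℚ`, `κ` cyclotomic, `p` odd and BAD `v` this becomes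
  `λ(X₀) ≤ λ(X) + Σ δ_E^{(v)}` (the `ℚ`-level sequel), i.e. the UPPER HALF of conclusion 4 of the
  registered fact `GreenbergVatsal2000.datumSelmer_nonPrimitive_invariants` (T-GV23L) — which the
  X2 lineage consumes only in that direction (X2-GAP §34.1 (b)). The LOWER half (GV Prop. (2.1),
  Poitou–Tate + Cassels) is NOT claimed.

References: [GreenbergVatsal2000] §2 Cor. (2.3), Prop. (2.4), pp. 20–22; [GreenbergLNM1716] §1 p. 60;
HOME X2-GAP.md §34.6.
-/

set_option autoImplicit false

noncomputable section

open scoped Classical AddSubgroup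

open NumberField IsDedekindDomain Field
open Literature.NumberTheory.GaloisRepresentations Literature.NumberTheory.EllipticCurves
  Literature.NumberTheory.EllipticCurves.GreenbergSelmer
  Literature.NumberTheory.EllipticCurves.GreenbergVatsal2000
  Literature.NumberTheory.EllipticCurves.IwasawaDual
  Summit.BirchSwinnertonDyer.Rank1Residual.Iwasawa

universe u

namespace Summit.BirchSwinnertonDyer.Rank1Residual.X2.NonPrimitiveLambdaShift

variable {K : Type u} [Field K] [NumberField K] (W : WeierstrassCurve K) [W.IsElliptic]
  {p : ℕ} [hp : Fact p.Prime] (κ : ZpExtension K p) {γ : absoluteGaloisGroup K}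
  (L : Data K (W.geomPrimaryTorsion p) p)

/-! ## §1. The kernel of the dual restriction is `Hom(S^{S₂}/S^{S₁}, ℚ/ℤ)` -/

omit [W.IsElliptic] in
/-- **`ker r ≃ Hom(S^{S₂}/S^{S₁}, ℚ/ℤ)`** for the dual `r : X₀ ↠ X` of `S^{S₁} ↪ S^{S₂}` (n1011's
`exists_restrictDual`, kernel `{x | toDual x kills S^{S₁}}`): a character of `S^{S₂}` vanishing on
`S^{S₁}` is a character of the quotient and conversely (`QuotientAddGroup.lift`). Pontryagin duality
of `0 → S^{S₁} → S^{S₂} → S^{S₂}/S^{S₁} → 0`. [cite: GreenbergVatsal2000, §2 Cor. (2.3) (arXiv:math/9906215 pp. 20–21)] -/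
theorem nonempty_ker_addEquiv_characterModule {S₁ S₂ : Set (HeightOneSpectrum (𝓞 K))} (h12 : S₁ ⊆ S₂)
    (X₀ : DatumDualData κ γ (W.geomPrimaryTorsion p) L S₂)
    {Y : Type*} [AddCommGroup Y] [Module (IwasawaAlgebra p) Y] (r : X₀.X →ₗ[IwasawaAlgebra p] Y)
    (hrker : ∀ x : X₀.X, r x = 0 ↔ ∀ s : datumSelmerInfty κ (W.geomPrimaryTorsion p) L S₁,
      X₀.toDual x (AddSubgroup.inclusion
        (datumSelmerInfty_mono κ h12 (W.geomPrimaryTorsion p) L) s) = 0) :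
    Nonempty (LinearMap.ker r ≃+
      CharacterModule (↥(datumSelmerInfty κ (W.geomPrimaryTorsion p) L S₂) ⧸
        (datumSelmerInfty κ (W.geomPrimaryTorsion p) L S₁).addSubgroupOf
          (datumSelmerInfty κ (W.geomPrimaryTorsion p) L S₂))) := by
  set SS := datumSelmerInfty κ (W.geomPrimaryTorsion p) L S₂ with hSS
  set S := datumSelmerInfty κ (W.geomPrimaryTorsion p) L S₁ with hS
  have hle : S ≤ SS := datumSelmerInfty_mono κ h12 (W.geomPrimaryTorsion p) L
  set N : AddSubgroup SS := S.addSubgroupOf SS with hN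
  have hNmem : ∀ s : SS, s ∈ N ↔ (s : W.subgroupH1 p κ.kerSubgroup) ∈ S := fun s ↦
    AddSubgroup.mem_addSubgroupOf
  let e₀ := AddEquiv.ofBijective X₀.toDual X₀.bijective
  have key : ∀ χ, X₀.toDual (e₀.symm χ) = χ := fun χ ↦ e₀.apply_symm_apply χ
  have hmk : ∀ s : S, QuotientAddGroup.mk' N (AddSubgroup.inclusion hle s) = 0 := fun s ↦ by
    rw [QuotientAddGroup.mk'_apply, QuotientAddGroup.eq_zero_iff, hNmem, AddSubgroup.coe_inclusion]
    exact s.2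
  have hmem : ∀ χ : CharacterModule (SS ⧸ N),
      e₀.symm (AddMonoidHom.comp χ (QuotientAddGroup.mk' N)) ∈ LinearMap.ker r := fun χ ↦ by
    rw [LinearMap.mem_ker, hrker]
    intro s
    rw [key, AddMonoidHom.comp_apply]
    exact (congrArg χ (hmk s)).trans (map_zero χ)
  let g : CharacterModule (SS ⧸ N) → LinearMap.ker r := fun χ ↦ ⟨_, hmem χ⟩
  have hg0 : g 0 = 0 := Subtype.ext (by
    change e₀.symm _ = 0
    rw [show AddMonoidHom.comp (0 : CharacterModule (SS ⧸ N)) (QuotientAddGroup.mk' N) = 0 from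
      AddMonoidHom.ext fun _ ↦ rfl, map_zero])
  have hgadd : ∀ χ χ', g (χ + χ') = g χ + g χ' := fun χ χ' ↦ Subtype.ext (by
    change e₀.symm _ = e₀.symm _ + e₀.symm _
    rw [← map_add]
    exact congrArg e₀.symm (AddMonoidHom.ext fun _ ↦ rfl))
  let g' : CharacterModule (SS ⧸ N) →+ LinearMap.ker r :=
    { toFun := g, map_zero' := hg0, map_add' := hgadd }
  have hgval : ∀ χ : CharacterModule (SS ⧸ N), X₀.toDual ((g' χ : LinearMap.ker r) : X₀.X) =
      AddMonoidHom.comp χ (QuotientAddGroup.mk' N) := fun χ ↦ key _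
  have hginj : Function.Injective g' := by
    intro χ χ' h
    have h1 : X₀.toDual ((g' χ : LinearMap.ker r) : X₀.X) = X₀.toDual ((g' χ' : LinearMap.ker r) : X₀.X) := by
      rw [h]
    rw [hgval, hgval] at h1
    refine AddMonoidHom.ext fun q ↦ ?_
    obtain ⟨s, rfl⟩ := QuotientAddGroup.mk'_surjective N q
    exact DFunLike.congr_fun h1 s
  have hgsurj : Function.Surjective g' := by
    rintro ⟨y, hy⟩
    have hkill : N ≤ (X₀.toDual y).ker := fun n hn ↦ by
      rw [AddMonoidHom.mem_ker]
      have h := (hrker y).1 (LinearMap.mem_ker.1 hy) ⟨(n : W.subgroupH1 p κ.kerSubgroup), (hNmem n).1 hn⟩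
      have e : AddSubgroup.inclusion hle ⟨(n : W.subgroupH1 p κ.kerSubgroup), (hNmem n).1 hn⟩ = n :=
        Subtype.ext (AddSubgroup.coe_inclusion _ _)
      rwa [e] at h
    refine ⟨QuotientAddGroup.lift N (X₀.toDual y) hkill, Subtype.ext ?_⟩
    change e₀.symm (AddMonoidHom.comp (QuotientAddGroup.lift N (X₀.toDual y) hkill)
      (QuotientAddGroup.mk' N)) = y
    apply X₀.bijective.1
    rw [key]
    exact AddMonoidHom.ext fun s ↦ QuotientAddGroup.lift_mk' N hkill s
  exact ⟨(AddEquiv.ofBijective g' ⟨hginj, hgsurj⟩).symm⟩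

/-! ## §2. The exact `λ`-shift `λ(X₀) = λ(X) + corank_{ℤ_p}(S^{S₀}/S)` -/

omit [W.IsElliptic] in
/-- `S^{S₀}/S` is `p`-primary (classes of `H¹(K_∞, E[p^∞])` are killed by powers of `p`).
[cite: GreenbergLNM1716, §1 p. 60] -/
theorem isPrimary_quotient (S₀ : Finset (HeightOneSpectrum (𝓞 K)))
    (q : ↥(datumSelmerInfty κ (W.geomPrimaryTorsion p) L (↑S₀ : Set (HeightOneSpectrum (𝓞 K)))) ⧸
      (datumSelmerInfty κ (W.geomPrimaryTorsion p) L (∅ : Set (HeightOneSpectrum (𝓞 K)))).addSubgroupOf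
        (datumSelmerInfty κ (W.geomPrimaryTorsion p) L (↑S₀ : Set (HeightOneSpectrum (𝓞 K))))) :
    ∃ n : ℕ, p ^ n • q = 0 := by
  induction q using QuotientAddGroup.induction_on with
  | H s =>
    obtain ⟨n, hn⟩ := W.exists_pow_smul_subgroupH1_ker_eq_zero κ
      (s : subgroupH1 κ.kerSubgroup (W.geomPrimaryTorsion p))
    refine ⟨n, ?_⟩
    have hs : p ^ n • s = 0 := Subtype.ext (by rw [AddSubgroupClass.coe_nsmul]; exact hn)
    rw [← QuotientAddGroup.mk_nsmul, hs, QuotientAddGroup.mk_zero]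

/-- **Greenberg–Vatsal 2000 Cor. (2.3) at the datum `(E[p^∞], C)`, conclusions 1–3 AND the exact
`λ`-shift**: for ANY data `L`, finitely decomposed `S₀`, a f.g. torsion dual datum `X` of `S_A(K_∞)`
and a dual datum `X₀` of `S^{Σ₀}_A(K_∞)`: `X₀` is f.g. and torsion, `μ(X₀) = μ(X)`, and
**`λ(X₀) = λ(X) + corank_{ℤ_p}(S^{Σ₀}_A(K_∞)/S_A(K_∞))`** ("`corank_𝒪` of a `Λ`-cotorsion group
being the `λ`-invariant of its dual", GV p. 21 — here for the kernel `Hom(S^{Σ₀}/S, ℚ/ℤ)` of the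
dual restriction, which is f.g. torsion with `μ = 0` because its reduction mod `p` is finite). What is
NOT here: the value `Σ_{ℓ∈Σ₀} s_ℓ d_ℓ` of that corank (GV Prop. (2.1) + (2.4)); its UPPER bound is §3.
[cite: GreenbergVatsal2000, §2 Cor. (2.3) and p. 21 (arXiv:math/9906215 pp. 20–21)] -/
theorem lambdaInvariant_eq_add_zpCorank_quotient (hγ : κ.IsTopGenerator γ)
    (S₀ : Finset (HeightOneSpectrum (𝓞 K)))
    (hD : ∀ v ∈ S₀, ((p : ℕ) : 𝓞 K) ∉ v.asIdeal → ∃ δ ∈ decomp (K := K) v, κ δ ≠ 1)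
    (X : DatumDualData κ γ (W.geomPrimaryTorsion p) L (∅ : Set (HeightOneSpectrum (𝓞 K))))
    [Module.Finite (IwasawaAlgebra p) X.X] (hX : Module.IsTorsion (IwasawaAlgebra p) X.X)
    (X₀ : DatumDualData κ γ (W.geomPrimaryTorsion p) L (↑S₀ : Set (HeightOneSpectrum (𝓞 K)))) :
    Module.Finite (IwasawaAlgebra p) X₀.X ∧ Module.IsTorsion (IwasawaAlgebra p) X₀.X ∧
      muInvariant p X₀.X = muInvariant p X.X ∧
      Finite ((↥(datumSelmerInfty κ (W.geomPrimaryTorsion p) L (↑S₀ : Set (HeightOneSpectrum (𝓞 K)))) ⧸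
        (datumSelmerInfty κ (W.geomPrimaryTorsion p) L (∅ : Set (HeightOneSpectrum (𝓞 K)))).addSubgroupOf
          (datumSelmerInfty κ (W.geomPrimaryTorsion p) L (↑S₀ : Set (HeightOneSpectrum (𝓞 K)))))[(p : ℤ)]) ∧
      lambdaInvariant p X₀.X = lambdaInvariant p X.X +
        zpCorank (↥(datumSelmerInfty κ (W.geomPrimaryTorsion p) L (↑S₀ : Set (HeightOneSpectrum (𝓞 K)))) ⧸
          (datumSelmerInfty κ (W.geomPrimaryTorsion p) L (∅ : Set (HeightOneSpectrum (𝓞 K)))).addSubgroupOf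
            (datumSelmerInfty κ (W.geomPrimaryTorsion p) L (↑S₀ : Set (HeightOneSpectrum (𝓞 K))))) p := by
  have h0 : (∅ : Set (HeightOneSpectrum (𝓞 K))) ⊆ ↑S₀ := Set.empty_subset _
  -- conclusions 1–3 (team n1011)
  obtain ⟨hfg₀, hX₀, hmu, -⟩ :=
    datumSelmer_nonPrimitive_moduleFinite_isTorsion_mu_eq W κ hγ L S₀ hD X hX X₀
  haveI := hfg₀
  -- the dual restriction `r : X₀ ↠ X`, its kernel `≅ Hom(S^{S₀}/S, ℚ/ℤ)`
  obtain ⟨r, -, hsurj, hker⟩ := exists_restrictDual W κ L h0 hγ X X₀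
  obtain ⟨Ψ⟩ := nonempty_ker_addEquiv_characterModule W κ L h0 X₀ r hker
  haveI : Finite (ModN (LinearMap.ker r) p) :=
    finite_modN_ker_of_cover W κ L h0 X₀ r hker
      (exists_finset_forall_sub_mem_of_nsmul_mem W κ hγ L S₀ hD)
  haveI : Module.Finite (IwasawaAlgebra p) (LinearMap.ker r) := moduleFinite_ker p r
  have hKt : Module.IsTorsion (IwasawaAlgebra p) (LinearMap.ker r) :=
    isTorsion_of_finite_modN p (LinearMap.ker r)
  have hKmu : muInvariant p (LinearMap.ker r) = 0 :=
    X2.MuVanishingOfFiniteModP.muInvariant_eq_zero_of_finite_modN p (LinearMap.ker r) hKt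
  obtain ⟨hfin, hcork⟩ :=
    X2.NonPrimitiveSelmerCorank.finite_torsionBy_and_zpCorank_eq_lambdaInvariant p (LinearMap.ker r)
      hKt hKmu (isPrimary_quotient W κ L S₀) Ψ
  refine ⟨hfg₀, hX₀, hmu, hfin, ?_⟩
  rw [X2.DualRestrictionInvariants.lambdaInvariant_eq_add_of_surjective p r hX₀ hsurj, hcork, add_comm]

/-! ## §3. The upper bound `λ(X₀) ≤ λ(X) + Σ_{v∈S₀} N_v c_v` from per-place corank bounds -/

/-- **`λ(X₀) ≤ λ(X) + Σ_{v∈S₀} N_v · c_v`** — the UPPER HALF of conclusion 4 of GV Cor. (2.3) in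
terms of the representative counts `N_v` (`Γ_K = H · D_v · {γⁿ : n < N_v}`, `hrep`) and per-place
bounds `c_v` on the corank formula of subgroups of `r_v(H¹(H, A))` (`hloc`): §2 and
`NonPrimitiveQuotientCorank.zpCorank_quotient_le_sum`. Conclusions 1–3 are restated.
[cite: GreenbergVatsal2000, §2 Cor. (2.3), Prop. (2.4) (arXiv:math/9906215 pp. 20–22)] -/
theorem lambdaInvariant_le_add_sum_of_local (hγ : κ.IsTopGenerator γ)
    (S₀ : Finset (HeightOneSpectrum (𝓞 K))) (hS₀ : ∀ v ∈ S₀, ((p : ℕ) : 𝓞 K) ∉ v.asIdeal)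
    (hD : ∀ v ∈ S₀, ((p : ℕ) : 𝓞 K) ∉ v.asIdeal → ∃ δ ∈ decomp (K := K) v, κ δ ≠ 1)
    (N c : HeightOneSpectrum (𝓞 K) → ℕ)
    (hrep : ∀ v ∈ S₀, ∀ σ : absoluteGaloisGroup K, ∃ n < N v, ∃ δ ∈ decomp (K := K) v,
      ∃ h ∈ κ.kerSubgroup, σ = h * (δ * γ ^ n))
    (hloc : ∀ v ∈ S₀, ∀ Y : AddSubgroup (discreteH1 (inertiaIn κ.kerSubgroup v) (W.geomPrimaryTorsion p)),
      (∀ y ∈ Y, ∃ c : subgroupH1 κ.kerSubgroup (W.geomPrimaryTorsion p),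
        resH1Hom (inertiaInToH κ.kerSubgroup v) (AddMonoidHom.id (W.geomPrimaryTorsion p))
          (fun _ _ ↦ rfl) c = y) →
      zpCorank Y p ≤ c v)
    (X : DatumDualData κ γ (W.geomPrimaryTorsion p) L (∅ : Set (HeightOneSpectrum (𝓞 K))))
    [Module.Finite (IwasawaAlgebra p) X.X] (hX : Module.IsTorsion (IwasawaAlgebra p) X.X)
    (X₀ : DatumDualData κ γ (W.geomPrimaryTorsion p) L (↑S₀ : Set (HeightOneSpectrum (𝓞 K)))) :
    Module.Finite (IwasawaAlgebra p) X₀.X ∧ Module.IsTorsion (IwasawaAlgebra p) X₀.X ∧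
      muInvariant p X₀.X = muInvariant p X.X ∧
      lambdaInvariant p X₀.X ≤ lambdaInvariant p X.X + ∑ v ∈ S₀, N v * c v := by
  obtain ⟨hfg₀, hX₀, hmu, -, hlam⟩ := lambdaInvariant_eq_add_zpCorank_quotient W κ L hγ S₀ hD X hX X₀
  have hb := NonPrimitiveQuotientCorank.zpCorank_quotient_le_sum W κ L S₀ hS₀ N c hrep hloc
  exact ⟨hfg₀, hX₀, hmu, by rw [hlam]; exact Nat.add_le_add_left hb _⟩

end Summit.BirchSwinnertonDyer.Rank1Residual.X2.NonPrimitiveLambdaShift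

end
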